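import Mathlib
import Literature.Analysis.FluidPDE.GaussianVortexPlanar
import Literature.Analysis.FluidPDE.GaussianVortexPlanarProofs
import Literature.Analysis.FluidPDE.BiotSavart2DSymmetry
import Summits.AnomalousDissipation.AnomalousDissipation.Theorems.MarginalStabilityChainStretchedVortexRowsStubLogPotentialTools
import Summits.AnomalousDissipation.AnomalousDissipation.Theorems.MarginalStabilityChainStretchedVortexRowsStubLogPotentialGradient
import HarnessLib

/-!
# Helper `logPotential_weak_poisson` toward stub `stub_coreInverse` of the line
# `braid-closed-large-circulation-gluing` (crux stmt-AnomalousDissipation-3009, `MarginalStabilityChain.StretchedVortexRows`)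

The weak Poisson equation for the logarithmic potential `ψ = N ∗ g`, `N = (2π)⁻¹ log ‖·‖`, of a `C¹` Gaussian-class
density on `ℝ² = EuclideanSpace ℝ (Fin 2)` (wave 3, toward `logPotential_neutral_energy`):

* polar coordinates for Bochner integrals on `EuclideanSpace ℝ (Fin 2)` (Mathlib's `integral_comp_polarCoord_symm`
  transported along the volume-preserving `ℝ² ≃ ℝ × ℝ`);
* **Green's identity in gradient form**, `∫ ⟪DN(ξ − η), ∇φ(ξ)⟫ dξ = −φ(η)` for `φ ∈ C¹_c` (`DN(z) = (2π‖z‖²)⁻¹ z`): in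
  polar coordinates about `η` the integrand times the Jacobian is `(2π)⁻¹ ∂_r φ(η + r u(θ))`, whose radial integral
  is `−(2π)⁻¹ φ(η)` for every angle (no regularisation needed);
* **`∫ ⟪∇ψ, ∇φ⟫ = −∫ g φ`** for every `φ ∈ C¹_c(ℝ²)`: `∇ψ = ∫ g(η) DN(· − η) dη` (helper `logPotential_gradient_eq`),
  Fubini (absolute convergence uniform in `ξ`: `‖DN‖ ∈ L¹_loc`, `g` Gaussian), and the Green identity.
-/

set_option linter.dupNamespace false
noncomputable section
open scoped RealInnerProductSpace Topology
open MeasureTheory WithLp Function Metric Filter Set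

namespace Summit.AnomalousDissipation.AnomalousDissipation.Theorems.MarginalStabilityChainStretchedVortexRows

open Literature.Analysis.FluidPDE

/-! ### Polar coordinates on `EuclideanSpace ℝ (Fin 2)`, Bochner form -/

/-- **Polar coordinates on `ℝ²`**: `∫ f = ∫_{r>0, θ∈(−π,π)} r · f(r cos θ, r sin θ)` for every `f : ℝ² → F` (Mathlib's
`integral_comp_polarCoord_symm` on `ℝ × ℝ`, transported along the volume-preserving `ℝ² ≃ ℝ × ℝ`). [folklore] -/
theorem integral_eq_integral_polar {F : Type*} [NormedAddCommGroup F] [NormedSpace ℝ F]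
    (f : EuclideanSpace ℝ (Fin 2) → F) :
    ∫ ξ, f ξ = ∫ p in Ioi (0:ℝ) ×ˢ Ioo (-Real.pi) Real.pi,
      p.1 • f (toLp 2 ![p.1 * Real.cos p.2, p.1 * Real.sin p.2]) := by
  set T : EuclideanSpace ℝ (Fin 2) ≃ᵐ ℝ × ℝ :=
    (MeasurableEquiv.toLp 2 (Fin 2 → ℝ)).symm.trans MeasurableEquiv.finTwoArrow with hT
  have hTmp : MeasurePreserving T volume volume :=
    (EuclideanSpace.volume_preserving_symm_measurableEquiv_toLp (Fin 2)).trans (volume_preserving_finTwoArrow ℝ)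
  have h1 : ∫ ξ, f ξ = ∫ q : ℝ × ℝ, f (T.symm q) := (hTmp.symm.integral_comp T.symm.measurableEmbedding f).symm
  rw [h1, ← integral_comp_polarCoord_symm]
  rfl

/-! ### The Green identity in gradient form: `∫ ⟪DN(ξ − η), ∇φ(ξ)⟫ dξ = −φ(η)` -/

/-- The unit circle map `u(θ) = (cos θ, sin θ)` is continuous, has norm one, and `(r cos θ, r sin θ) = r u(θ)`. [folklore] -/
theorem circleDir_props :
    (Continuous fun θ : ℝ => (toLp 2 ![Real.cos θ, Real.sin θ] : EuclideanSpace ℝ (Fin 2))) ∧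
      (∀ θ : ℝ, ‖(toLp 2 ![Real.cos θ, Real.sin θ] : EuclideanSpace ℝ (Fin 2))‖ = 1) ∧
      ∀ r θ : ℝ, (toLp 2 ![r * Real.cos θ, r * Real.sin θ] : EuclideanSpace ℝ (Fin 2)) =
        r • toLp 2 ![Real.cos θ, Real.sin θ] := by
  refine ⟨(PiLp.continuous_toLp 2 _).comp (continuous_pi fun i => ?_), fun θ => ?_, fun r θ => ?_⟩
  · fin_cases i
    · exact Real.continuous_cos
    · exact Real.continuous_sin
  · have h2 : ‖(toLp 2 ![Real.cos θ, Real.sin θ] : EuclideanSpace ℝ (Fin 2))‖ ^ 2 = 1 := by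
      rw [EuclideanSpace.real_norm_sq_eq, Fin.sum_univ_two]
      simp [Real.cos_sq_add_sin_sq]
    have h0 := norm_nonneg (toLp 2 ![Real.cos θ, Real.sin θ] : EuclideanSpace ℝ (Fin 2))
    nlinarith
  · ext i
    fin_cases i <;> simp

/-- **Green's identity for the logarithmic kernel, gradient form**: for `φ ∈ C¹_c(ℝ²)` and every `η`,
`∫ (2π‖ξ−η‖²)⁻¹ ⟪∇φ(ξ), ξ − η⟫ dξ = −φ(η)`, i.e. `∫ ⟪DN(ξ − η), ∇φ(ξ)⟫ dξ = −φ(η)` with `DN(z) = (2π‖z‖²)⁻¹ z`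
(`ΔN = δ` in the weak sense). Proof by polar coordinates about `η`: the integrand times the Jacobian `r` is
`(2π)⁻¹ ∂_r[φ(η + r u(θ))]`, whose radial integral is `−(2π)⁻¹ φ(η)` for every angle. [folklore] -/
theorem integral_gradLogKernel_inner_gradient {φ : EuclideanSpace ℝ (Fin 2) → ℝ} (hφ : ContDiff ℝ 1 φ)
    (hφc : HasCompactSupport φ) (η : EuclideanSpace ℝ (Fin 2)) :
    ∫ ξ, (2 * Real.pi * ‖ξ - η‖ ^ 2)⁻¹ * ⟪gradient φ ξ, ξ - η⟫ = -φ η := by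
  obtain ⟨huc, hun', hru'⟩ := circleDir_props
  set u : ℝ → EuclideanSpace ℝ (Fin 2) := fun θ => toLp 2 ![Real.cos θ, Real.sin θ] with hu
  have hun : ∀ θ : ℝ, ‖u θ‖ = 1 := hun'
  have hru : ∀ r θ : ℝ, (toLp 2 ![r * Real.cos θ, r * Real.sin θ] : EuclideanSpace ℝ (Fin 2)) = r • u θ := hru'
  have hφd : Differentiable ℝ φ := hφ.differentiable one_ne_zero
  have hgc : Continuous (gradient φ) :=
    (InnerProductSpace.toDual ℝ (EuclideanSpace ℝ (Fin 2))).symm.continuous.comp (hφ.continuous_fderiv one_ne_zero)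
  -- support
  obtain ⟨R, hR⟩ := hφc.isCompact.isBounded.subset_closedBall 0
  set R₀ : ℝ := max R 0 + 1 with hR₀
  have hR₀pos : 0 < R₀ := by simp only [hR₀]; positivity
  have hzero : ∀ x : EuclideanSpace ℝ (Fin 2), R₀ ≤ ‖x‖ → φ x = 0 ∧ gradient φ x = 0 := by
    intro x hx
    have hx' : x ∉ tsupport φ := fun h => by
      have := mem_closedBall_zero_iff.1 (hR h)
      simp only [hR₀] at hx
      linarith [le_max_left R 0]
    refine ⟨image_eq_zero_of_notMem_tsupport hx', ?_⟩
    have : fderiv ℝ φ x = 0 := image_eq_zero_of_notMem_tsupport fun h => hx' (tsupport_fderiv_subset ℝ h)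
    rw [gradient, this, map_zero]
  set R₁ : ℝ := R₀ + ‖η‖ with hR₁
  have hR₁ : 0 ≤ R₁ := by positivity
  have hfar : ∀ r θ : ℝ, R₁ ≤ r → φ (r • u θ + η) = 0 ∧ gradient φ (r • u θ + η) = 0 := by
    intro r θ hr
    refine hzero _ ?_
    have h1 : ‖r • u θ‖ = r := by
      rw [norm_smul, hun, mul_one, Real.norm_eq_abs, abs_of_nonneg (by linarith [norm_nonneg η])]
    have h2 := norm_sub_le (r • u θ + η) η
    rw [add_sub_cancel_right, h1] at h2
    linarith
  -- Step 1: translate to `η = 0` and pass to polar coordinates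
  have h1 : ∫ ξ, (2 * Real.pi * ‖ξ - η‖ ^ 2)⁻¹ * ⟪gradient φ ξ, ξ - η⟫ =
      ∫ z, (2 * Real.pi * ‖z‖ ^ 2)⁻¹ * ⟪gradient φ (z + η), z⟫ := by
    rw [← integral_add_right_eq_self _ η]
    simp only [add_sub_cancel_right]
  rw [h1, integral_eq_integral_polar]
  set G : ℝ × ℝ → ℝ := fun p => (2 * Real.pi)⁻¹ * ⟪gradient φ (p.1 • u p.2 + η), u p.2⟫ with hG
  have h3 : ∀ p ∈ Ioi (0:ℝ) ×ˢ Ioo (-Real.pi) Real.pi,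
      p.1 • ((2 * Real.pi * ‖(toLp 2 ![p.1 * Real.cos p.2, p.1 * Real.sin p.2] : EuclideanSpace ℝ (Fin 2))‖ ^ 2)⁻¹ *
        ⟪gradient φ ((toLp 2 ![p.1 * Real.cos p.2, p.1 * Real.sin p.2] : EuclideanSpace ℝ (Fin 2)) + η),
          (toLp 2 ![p.1 * Real.cos p.2, p.1 * Real.sin p.2] : EuclideanSpace ℝ (Fin 2))⟫) = G p := by
    rintro ⟨r, θ⟩ ⟨hr, -⟩
    have hr' : (0:ℝ) < r := hr
    simp only [hG, hru, norm_smul, hun, mul_one, Real.norm_eq_abs, abs_of_pos hr', inner_smul_right, smul_eq_mul]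
    field_simp
  rw [setIntegral_congr_fun (measurableSet_Ioi.prod measurableSet_Ioo) h3]
  -- Step 2: integrability on the target and iterated integration
  have hGc : Continuous G := by
    refine continuous_const.mul (Continuous.inner (hgc.comp ?_) (huc.comp continuous_snd))
    exact (continuous_fst.smul (huc.comp continuous_snd)).add continuous_const
  have hG0 : ∀ p : ℝ × ℝ, R₁ ≤ p.1 → G p = 0 := fun p hp => by
    simp only [hG, (hfar p.1 p.2 hp).2, inner_zero_left, mul_zero]
  have hGi : IntegrableOn G (Ioi (0:ℝ) ×ˢ Ioo (-Real.pi) Real.pi) := by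
    have hK : IntegrableOn G (Icc 0 R₁ ×ˢ Icc (-Real.pi) Real.pi) :=
      hGc.continuousOn.integrableOn_compact (isCompact_Icc.prod isCompact_Icc)
    have hZ : IntegrableOn G (Ici R₁ ×ˢ (univ : Set ℝ)) :=
      integrableOn_zero.congr_fun (fun p hp => (hG0 p hp.1).symm) (measurableSet_Ici.prod MeasurableSet.univ)
    refine (hK.union hZ).mono_set ?_
    rintro ⟨r, θ⟩ ⟨hr, hθ⟩
    by_cases h : r ≤ R₁
    · exact Or.inl ⟨⟨le_of_lt hr, h⟩, Ioo_subset_Icc_self hθ⟩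
    · exact Or.inr ⟨le_of_lt (not_le.1 h), mem_univ _⟩
  rw [Measure.volume_eq_prod, ← Measure.prod_restrict]
  have hGi' : Integrable G ((volume.restrict (Ioi (0:ℝ))).prod (volume.restrict (Ioo (-Real.pi) Real.pi))) := by
    rw [Measure.prod_restrict, ← Measure.volume_eq_prod]; exact hGi
  rw [integral_prod_symm G hGi']
  -- Step 3: the radial integral is `−(2π)⁻¹ φ(η)` for every angle
  have hinner : ∀ θ : ℝ, ∫ r in Ioi (0:ℝ), G (r, θ) = -((2 * Real.pi)⁻¹ * φ η) := by
    intro θ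
    have hγ : ∀ r : ℝ, HasDerivAt (fun r : ℝ => r • u θ + η) (u θ) r := fun r => by
      have h := ((hasDerivAt_id r).smul_const (u θ)).add_const η
      rw [one_smul] at h
      exact h
    have hderiv : ∀ r : ℝ, HasDerivAt (fun r : ℝ => (2 * Real.pi)⁻¹ * φ (r • u θ + η)) (G (r, θ)) r := by
      intro r
      have h := ((hφd (r • u θ + η)).hasFDerivAt.comp_hasDerivAt r (hγ r)).const_mul (2 * Real.pi)⁻¹
      refine h.congr_deriv ?_
      simp only [hG, gradient, InnerProductSpace.toDual_symm_apply]
    have hcont : Continuous fun r : ℝ => (2 * Real.pi)⁻¹ * φ (r • u θ + η) :=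
      continuous_const.mul (hφ.continuous.comp ((continuous_id.smul continuous_const).add continuous_const))
    have hGθ : Continuous fun r : ℝ => G (r, θ) := hGc.comp (continuous_id.prodMk continuous_const)
    have hint : IntegrableOn (fun r : ℝ => G (r, θ)) (Ioi 0) := by
      have hK : IntegrableOn (fun r : ℝ => G (r, θ)) (Icc 0 R₁) := hGθ.continuousOn.integrableOn_Icc
      have hZ : IntegrableOn (fun r : ℝ => G (r, θ)) (Ici R₁) :=
        integrableOn_zero.congr_fun (fun r hr => (hG0 (r, θ) hr).symm) measurableSet_Ici
      refine (hK.union hZ).mono_set fun r hr => ?_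
      by_cases h : r ≤ R₁
      · exact Or.inl ⟨le_of_lt hr, h⟩
      · exact Or.inr (le_of_lt (not_le.1 h))
    have hlim : Tendsto (fun r : ℝ => (2 * Real.pi)⁻¹ * φ (r • u θ + η)) atTop (𝓝 0) := by
      refine tendsto_const_nhds.congr' ?_
      filter_upwards [eventually_ge_atTop R₁] with r hr
      rw [(hfar r θ hr).1, mul_zero]
    rw [integral_Ioi_of_hasDerivAt_of_tendsto hcont.continuousWithinAt (fun r _ => hderiv r) hint hlim]
    simp
  simp_rw [hinner]
  rw [setIntegral_const, Real.volume_real_Ioo_of_le (by linarith [Real.pi_pos]), smul_eq_mul]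
  field_simp
  ring

/-! ### The weak Poisson equation `∫ ⟪∇ψ, ∇φ⟫ = −∫ g φ` -/

section Weak

variable {B : ℝ} {g : EuclideanSpace ℝ (Fin 2) → ℝ} (hg : ContDiff ℝ 1 g)
  (hg0 : ∀ η, |g η| ≤ B * Real.exp (-(1 / 8) * ‖η‖ ^ 2))
  (hg1 : ∀ η, ‖fderiv ℝ g η‖ ≤ B * Real.exp (-(1 / 8) * ‖η‖ ^ 2))

include hg0 in
/-- Uniform bound for the absolutely convergent gradient integrals: `∫ ‖g(η) DN(ξ − η)‖ dη ≤ M` for all `ξ`. [folklore] -/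
theorem exists_integral_norm_smul_gradLogKernel_le (hgc : Continuous g) :
    ∃ M : ℝ, ∀ ξ : EuclideanSpace ℝ (Fin 2),
      ∫ η, ‖g η • ((2 * Real.pi * ‖ξ - η‖ ^ 2)⁻¹ • (ξ - η))‖ ≤ M := by
  have hB : 0 ≤ B := (abs_nonneg _).trans ((hg0 0).trans (le_of_eq (by simp)))
  have hI := integrable_one_add_norm_pow_mul_exp_eighth 0
  simp only [pow_zero, one_mul] at hI
  refine ⟨(2 * Real.pi)⁻¹ * B *
    ((∫ z, (ball (0 : EuclideanSpace ℝ (Fin 2)) 1).indicator (fun z => ‖z‖⁻¹) z) +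
      ∫ η : EuclideanSpace ℝ (Fin 2), Real.exp (-(1 / 8) * ‖η‖ ^ 2)), fun ξ => ?_⟩
  have h1 : Integrable fun η : EuclideanSpace ℝ (Fin 2) =>
      (ball (0 : EuclideanSpace ℝ (Fin 2)) 1).indicator (fun z => ‖z‖⁻¹) (ξ - η) :=
    integrable_indicator_inv_norm.comp_sub_left ξ
  have hle : ∀ η, ‖g η • ((2 * Real.pi * ‖ξ - η‖ ^ 2)⁻¹ • (ξ - η))‖ ≤ (2 * Real.pi)⁻¹ * B *
      ((ball (0 : EuclideanSpace ℝ (Fin 2)) 1).indicator (fun z => ‖z‖⁻¹) (ξ - η) +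
        Real.exp (-(1 / 8) * ‖η‖ ^ 2)) := by
    intro η
    rw [norm_smul, norm_gradLogKernel, Real.norm_eq_abs]
    have he : Real.exp (-(1 / 8) * ‖η‖ ^ 2) ≤ 1 := Real.exp_le_one_iff.2 (by nlinarith [norm_nonneg η])
    have he0 : 0 ≤ Real.exp (-(1 / 8) * ‖η‖ ^ 2) := (Real.exp_pos _).le
    have hi0 : 0 ≤ ‖ξ - η‖⁻¹ := inv_nonneg.2 (norm_nonneg _)
    have key : ‖ξ - η‖⁻¹ * Real.exp (-(1 / 8) * ‖η‖ ^ 2) ≤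
        (ball (0 : EuclideanSpace ℝ (Fin 2)) 1).indicator (fun z => ‖z‖⁻¹) (ξ - η) + Real.exp (-(1 / 8) * ‖η‖ ^ 2) := by
      by_cases hb : ξ - η ∈ ball (0 : EuclideanSpace ℝ (Fin 2)) 1
      · rw [indicator_of_mem hb]; nlinarith
      · rw [indicator_of_notMem hb, zero_add]
        have h3 : ‖ξ - η‖⁻¹ ≤ 1 := inv_le_one_of_one_le₀ (by simpa [mem_ball_zero_iff] using hb)
        nlinarith
    calc |g η| * ((2 * Real.pi)⁻¹ * ‖ξ - η‖⁻¹)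
        ≤ B * Real.exp (-(1 / 8) * ‖η‖ ^ 2) * ((2 * Real.pi)⁻¹ * ‖ξ - η‖⁻¹) :=
          mul_le_mul_of_nonneg_right (hg0 η) (by positivity)
      _ = (2 * Real.pi)⁻¹ * B * (‖ξ - η‖⁻¹ * Real.exp (-(1 / 8) * ‖η‖ ^ 2)) := by ring
      _ ≤ _ := mul_le_mul_of_nonneg_left key (by positivity)
  calc ∫ η, ‖g η • ((2 * Real.pi * ‖ξ - η‖ ^ 2)⁻¹ • (ξ - η))‖
      ≤ ∫ η, (2 * Real.pi)⁻¹ * B * ((ball (0 : EuclideanSpace ℝ (Fin 2)) 1).indicator (fun z => ‖z‖⁻¹) (ξ - η) +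
          Real.exp (-(1 / 8) * ‖η‖ ^ 2)) :=
        integral_mono (integrable_smul_gradLogKernel hgc hg0 ξ).norm ((h1.add hI).const_mul _) hle
    _ = _ := by
        rw [integral_const_mul, integral_add h1 hI,
          integral_sub_left_eq_self ((ball (0 : EuclideanSpace ℝ (Fin 2)) 1).indicator fun z => ‖z‖⁻¹) volume ξ]

include hg hg0 hg1 in
/-- **The weak Poisson equation for the logarithmic potential**: for `ψ = N ∗ g` (`g ∈ C¹` of Gaussian class) and every
test function `φ ∈ C¹_c(ℝ²)`, `∫ ⟪∇ψ, ∇φ⟫ = −∫ g φ` (`∇ψ = ∫ g(η) DN(· − η) dη`, Fubini, and the gradient-form Green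
identity `∫ ⟪DN(ξ − η), ∇φ(ξ)⟫ dξ = −φ(η)`). [folklore] -/
theorem integral_inner_gradient_logPotential_gradient {φ : EuclideanSpace ℝ (Fin 2) → ℝ} (hφ : ContDiff ℝ 1 φ)
    (hφc : HasCompactSupport φ) :
    ∫ ξ, ⟪gradient (fun ξ : EuclideanSpace ℝ (Fin 2) => ∫ η, (2 * Real.pi)⁻¹ * Real.log ‖ξ - η‖ * g η) ξ,
        gradient φ ξ⟫ = -∫ η, g η * φ η := by
  have hgrad := logPotential_gradient_eq B g hg hg0 hg1
  have hφg : Continuous (gradient φ) :=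
    (InnerProductSpace.toDual ℝ (EuclideanSpace ℝ (Fin 2))).symm.continuous.comp (hφ.continuous_fderiv one_ne_zero)
  -- Step 1: the pairing as an iterated integral
  have h1 : ∀ ξ, ⟪gradient (fun ξ : EuclideanSpace ℝ (Fin 2) => ∫ η, (2 * Real.pi)⁻¹ * Real.log ‖ξ - η‖ * g η) ξ,
      gradient φ ξ⟫ = ∫ η, g η * ((2 * Real.pi * ‖ξ - η‖ ^ 2)⁻¹ * ⟪gradient φ ξ, ξ - η⟫) := by
    intro ξ
    obtain ⟨hint, hgr⟩ := hgrad ξ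
    rw [hgr, real_inner_comm, ← integral_inner hint]
    refine integral_congr_ae (Eventually.of_forall fun η => ?_)
    simp only [real_inner_smul_right]
  simp_rw [h1]
  -- Step 2: Fubini
  set F : EuclideanSpace ℝ (Fin 2) → EuclideanSpace ℝ (Fin 2) → ℝ := fun ξ η =>
    g η * ((2 * Real.pi * ‖ξ - η‖ ^ 2)⁻¹ * ⟪gradient φ ξ, ξ - η⟫) with hF
  have hFmeas : Measurable (uncurry F) := by
    refine (hg.continuous.measurable.comp measurable_snd).mul ((Measurable.inv ?_).mul ?_)
    · exact measurable_const.mul ((measurable_fst.sub measurable_snd).norm.pow_const 2)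
    · exact ((hφg.comp continuous_fst).inner (continuous_fst.sub continuous_snd)).measurable
  have hFm : AEStronglyMeasurable (uncurry F)
      ((volume : Measure (EuclideanSpace ℝ (Fin 2))).prod (volume : Measure (EuclideanSpace ℝ (Fin 2)))) :=
    hFmeas.aestronglyMeasurable
  have hnormF : ∀ ξ η, ‖F ξ η‖ ≤ ‖g η • ((2 * Real.pi * ‖ξ - η‖ ^ 2)⁻¹ • (ξ - η))‖ * ‖gradient φ ξ‖ := by
    intro ξ η
    simp only [hF, norm_mul, norm_smul]
    have := abs_real_inner_le_norm (gradient φ ξ) (ξ - η)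
    rw [Real.norm_eq_abs, Real.norm_eq_abs, Real.norm_eq_abs]
    calc |g η| * (|(2 * Real.pi * ‖ξ - η‖ ^ 2)⁻¹| * |⟪gradient φ ξ, ξ - η⟫|)
        ≤ |g η| * (|(2 * Real.pi * ‖ξ - η‖ ^ 2)⁻¹| * (‖gradient φ ξ‖ * ‖ξ - η‖)) := by gcongr
      _ = _ := by ring
  have hrow : ∀ ξ, Integrable (F ξ) := fun ξ =>
    (((integrable_smul_gradLogKernel hg.continuous hg0 ξ).norm.mul_const ‖gradient φ ξ‖)).mono'
      (hFmeas.comp (measurable_const.prodMk measurable_id)).aestronglyMeasurable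
      (Eventually.of_forall (hnormF ξ))
  obtain ⟨M, hM⟩ := exists_integral_norm_smul_gradLogKernel_le hg0 hg.continuous
  have hgradc : HasCompactSupport (gradient φ) :=
    (hφc.fderiv (𝕜 := ℝ)).comp_left
      (g := fun L => (InnerProductSpace.toDual ℝ (EuclideanSpace ℝ (Fin 2))).symm L) (map_zero _)
  have hbd : Integrable fun ξ : EuclideanSpace ℝ (Fin 2) => M * ‖gradient φ ξ‖ :=
    (hφg.norm.integrable_of_hasCompactSupport hgradc.norm).const_mul M
  have hrowbd : ∀ ξ, ∫ η, ‖F ξ η‖ ≤ M * ‖gradient φ ξ‖ := by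
    intro ξ
    calc ∫ η, ‖F ξ η‖ ≤ ∫ η, ‖g η • ((2 * Real.pi * ‖ξ - η‖ ^ 2)⁻¹ • (ξ - η))‖ * ‖gradient φ ξ‖ :=
          integral_mono (hrow ξ).norm
            ((integrable_smul_gradLogKernel hg.continuous hg0 ξ).norm.mul_const _) (hnormF ξ)
      _ = (∫ η, ‖g η • ((2 * Real.pi * ‖ξ - η‖ ^ 2)⁻¹ • (ξ - η))‖) * ‖gradient φ ξ‖ := integral_mul_const _ _
      _ ≤ M * ‖gradient φ ξ‖ := mul_le_mul_of_nonneg_right (hM ξ) (norm_nonneg _)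
  have hGi : Integrable (uncurry F)
      ((volume : Measure (EuclideanSpace ℝ (Fin 2))).prod (volume : Measure (EuclideanSpace ℝ (Fin 2)))) := by
    rw [integrable_prod_iff hFm]
    refine ⟨Eventually.of_forall hrow, hbd.mono' hFm.norm.integral_prod_right' (Eventually.of_forall fun ξ => ?_)⟩
    rw [Real.norm_of_nonneg (integral_nonneg fun η => norm_nonneg _)]
    exact hrowbd ξ
  rw [integral_integral_swap hGi]
  -- Step 3: the inner integral is `−g(η) φ(η)` by the Green identity
  have h3 : ∀ η, ∫ ξ, F ξ η = -(g η * φ η) := fun η => by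
    simp only [hF]
    rw [integral_const_mul, integral_gradLogKernel_inner_gradient hφ hφc η]
    ring
  simp_rw [h3]
  rw [integral_neg]

end Weak

/-! ### The registered helper -/

/-- **Weak Poisson equation for the logarithmic potential** `ψ = N ∗ g`, `N = (2π)⁻¹ log ‖·‖`, of a `C¹` density with
Gaussian bounds `|g|, ‖Dg‖ ≤ B e^{−‖η‖²/8}`: `∫ ⟪∇ψ, ∇φ⟫ = −∫ g φ` for every `φ ∈ C¹_c(ℝ²)` (registered helper toward
`logPotential_neutral_energy` / `stub_coreInverse`). [folklore] -/
theorem logPotential_weak_poisson :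
    ∀ (B : ℝ) (g : EuclideanSpace ℝ (Fin 2) → ℝ), ContDiff ℝ 1 g →
      (∀ η, |g η| ≤ B * Real.exp (-(1 / 8) * ‖η‖ ^ 2)) →
      (∀ η, ‖fderiv ℝ g η‖ ≤ B * Real.exp (-(1 / 8) * ‖η‖ ^ 2)) →
      ∀ φ : EuclideanSpace ℝ (Fin 2) → ℝ, ContDiff ℝ 1 φ → HasCompactSupport φ →
        ∫ ξ, ⟪gradient (fun ξ : EuclideanSpace ℝ (Fin 2) => ∫ η, (2 * Real.pi)⁻¹ * Real.log ‖ξ - η‖ * g η) ξ,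
            gradient φ ξ⟫ = -∫ η, g η * φ η :=
  fun _ _ hg hg0 hg1 _ hφ hφc => integral_inner_gradient_logPotential_gradient hg hg0 hg1 hφ hφc

end Summit.AnomalousDissipation.AnomalousDissipation.Theorems.MarginalStabilityChainStretchedVortexRows

end
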